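import Mathlib
import HarnessLib
import Summits.Parity.BatemanHorn.Theorems.IsogenyRedeiSplitBlockJacobiCornerMbbBlock

/-!
# Support lemmas for `stub_mbb_of_boxInputs` (line `Sketch`, crux `SplitBlockJacobiCorner`,
# stmt-Parity-15002): the abstract Type-II piece bound

Kernel-free.  A Type-II piece `Σ_{b,r ≤ t : P < br ≤ t} a(b) c(r) F(br)` with unit-bounded
coefficients supported on `b, r > U` is cut into dyadic blocks `(U2^i, U2^{i+1}] × (U2^j, U2^{j+1}]`;
on each ACTIVE block (one meeting the cut region) the conclusion of the block lemma `block_bound`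
(`…CornerMbbBlock`) is taken as the hypothesis `hblock` (supplied later from K2′), and the window
terms are counted with `τ` (`sum_block_window_le`).  Result: `typeII_piece_bound`.
-/

noncomputable section

open Finset

namespace Summit.Parity.BatemanHorn.Cruxes.SplitBlockJacobiCorner.Sketch.MbbOfBoxInputs

/-- Dyadic splitting of `(U, U·2^I]` into the blocks `(U2^i, 2·U2^i]`, `i < I`. [folklore] -/
theorem sum_Ioc_dyadic {β : Type*} [AddCommMonoid β] (f : ℕ → β) (U I : ℕ) :
    ∑ b ∈ Ioc U (U * 2 ^ I), f b = ∑ i ∈ range I, ∑ b ∈ Ioc (U * 2 ^ i) (2 * (U * 2 ^ i)), f b := by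
  induction I with
  | zero => simp
  | succ I ih =>
    rw [Finset.sum_range_succ, ← ih]
    have h1 : U ≤ U * 2 ^ I := Nat.le_mul_of_pos_right U (Nat.two_pow_pos I)
    have h2 : U * 2 ^ I ≤ U * 2 ^ (I + 1) := Nat.mul_le_mul_left U (Nat.pow_le_pow_right (by norm_num) (by omega))
    rw [show 2 * (U * 2 ^ I) = U * 2 ^ (I + 1) by ring]
    exact (Finset.sum_Ioc_consecutive f h1 h2).symm

/-- Extending the range of a sum whose summand vanishes off `(U, t]`. [folklore] -/
theorem sum_Ioc_zero_eq_sum_Ioc_of_support {β : Type*} [AddCommMonoid β] (f : ℕ → β) {U t T : ℕ}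
    (htT : t ≤ T) (h0 : ∀ b, b ≤ U → f b = 0) (h1 : ∀ b, t < b → f b = 0) :
    ∑ b ∈ Ioc 0 t, f b = ∑ b ∈ Ioc U T, f b := by
  rcases le_total U t with hUt | hUt
  · have hA : ∑ b ∈ Ioc U t, f b = ∑ b ∈ Ioc 0 t, f b := by
      apply Finset.sum_subset
      · intro b hb; rw [Finset.mem_Ioc] at hb ⊢; omega
      · intro b hb hb'
        rw [Finset.mem_Ioc] at hb hb'
        exact h0 b (by omega)
    have hB : ∑ b ∈ Ioc U t, f b = ∑ b ∈ Ioc U T, f b := by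
      apply Finset.sum_subset
      · intro b hb; rw [Finset.mem_Ioc] at hb ⊢; omega
      · intro b hb hb'
        rw [Finset.mem_Ioc] at hb hb'
        exact h1 b (by omega)
    rw [← hA, hB]
  · rw [Finset.sum_eq_zero (fun b hb => h0 b (by rw [Finset.mem_Ioc] at hb; omega)),
      Finset.sum_eq_zero (fun b hb => h1 b (by rw [Finset.mem_Ioc] at hb; omega))]

/-- The two windows of the block lemma contain at most `⌊P/W⌋ + ⌊t/W⌋` integers. [folklore] -/
theorem card_window_le (N P t W : ℕ) :
    ((Ioc 0 N).filter (fun n : ℕ =>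
        (P < n ∧ n ≤ P + P / W) ∨ (n ≤ t ∧ t < n + t / W))).card ≤ P / W + t / W := by
  calc _ ≤ (Ioc P (P + P / W) ∪ Ioc (t - t / W) t).card := by
        refine Finset.card_le_card fun n hn => ?_
        rw [Finset.mem_filter] at hn
        rw [Finset.mem_union, Finset.mem_Ioc, Finset.mem_Ioc]
        rcases hn.2 with h | h
        · exact Or.inl h
        · right
          have : t / W ≤ t := Nat.div_le_self t W
          omega
    _ ≤ (Ioc P (P + P / W)).card + (Ioc (t - t / W) t).card := Finset.card_union_le _ _
    _ = P / W + t / W := by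
        rw [Nat.card_Ioc, Nat.card_Ioc]
        have h1 : t / W ≤ t := Nat.div_le_self t W
        generalize P / W = a at *
        generalize t / W = b at *
        omega

/-- **The abstract Type-II piece bound.**  Coefficients `a, c` supported on `(U, ∞)`, `F`
arbitrary; `I` dyadic blocks per variable (`t ≤ U·2^I`), `W ≥ 1` sub-intervals.
If (i) on every active block the product forms are bounded by `Y` (the block lemma `block_bound`
is passed in as the hypothesis `hblock`, see `…CornerMbbBlock`), and (ii) `τ(n)‖F(n)‖ ≤ Φ` for
`n ≤ 2P` (with `t ≤ 2P`), then the cut piece is at most `I² (W·Y + (P/W + t/W)·Φ)`. [folklore] -/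
theorem typeII_piece_bound (F : ℕ → ℂ) (a c : ℕ → ℂ)
    (U P t W I : ℕ) (hU : 1 ≤ U) (ht : t ≤ 2 * P) (hI : t ≤ U * 2 ^ I)
    (ha0 : ∀ b, b ≤ U → a b = 0) (hc0 : ∀ r, r ≤ U → c r = 0)
    {Y Φ : ℝ} (hY : 0 ≤ Y) (hΦ0 : 0 ≤ Φ)
    (hΦ : ∀ n, n ≤ 2 * P → (n.divisors.card : ℝ) * ‖F n‖ ≤ Φ)
    (hblock : ∀ M R : ℕ, (∃ i < I, M = U * 2 ^ i) → (∃ j < I, R = U * 2 ^ j) →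
      M * R < t → P < 4 * M * R →
      ‖∑ m ∈ Ioc M (2 * M), ∑ r ∈ Ioc R (2 * R),
          (if P < m * r ∧ m * r ≤ t then a m * c r * F (m * r) else 0)‖ ≤
        W * Y + ∑ m ∈ Ioc M (2 * M), ∑ r ∈ Ioc R (2 * R),
          (if (P < m * r ∧ m * r ≤ P + P / W) ∨ (m * r ≤ t ∧ t < m * r + t / W) then ‖F (m * r)‖
            else 0)) :
    ‖∑ b ∈ Ioc 0 t, ∑ r ∈ Ioc 0 t,
        (if P < b * r ∧ b * r ≤ t then a b * c r * F (b * r) else 0)‖ ≤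
      (I : ℝ) ^ 2 * (W * Y + (P / W + t / W : ℕ) * Φ) := by
  set f : ℕ → ℕ → ℂ := fun b r => if P < b * r ∧ b * r ≤ t then a b * c r * F (b * r) else 0
    with hf
  -- (1) move both variables to `(U, U·2^I]`
  have hinner : ∀ b, 1 ≤ b → ∑ r ∈ Ioc 0 t, f b r = ∑ r ∈ Ioc U (U * 2 ^ I), f b r := by
    intro b hb
    apply sum_Ioc_zero_eq_sum_Ioc_of_support (f b) hI
    · intro r hr; simp only [hf, hc0 r hr, mul_zero, zero_mul, ite_self]
    · intro r hr
      simp only [hf]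
      rw [if_neg]
      intro h
      have : t < b * r := lt_of_lt_of_le hr (Nat.le_mul_of_pos_left r hb)
      omega
  have houter : ∑ b ∈ Ioc 0 t, ∑ r ∈ Ioc 0 t, f b r =
      ∑ b ∈ Ioc U (U * 2 ^ I), ∑ r ∈ Ioc U (U * 2 ^ I), f b r := by
    rw [Finset.sum_congr rfl fun b hb => hinner b (Finset.mem_Ioc.mp hb).1]
    apply sum_Ioc_zero_eq_sum_Ioc_of_support (fun b => ∑ r ∈ Ioc U (U * 2 ^ I), f b r) hI
    · intro b hb
      refine Finset.sum_eq_zero fun r _ => ?_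
      simp only [hf, ha0 b hb, zero_mul, ite_self]
    · intro b hb
      refine Finset.sum_eq_zero fun r hr => ?_
      simp only [hf]
      rw [if_neg]
      intro h
      have hr1 : 1 ≤ r := by have := (Finset.mem_Ioc.mp hr).1; omega
      have : t < b * r := lt_of_lt_of_le hb (Nat.le_mul_of_pos_right b hr1)
      omega
  -- (2) dyadic blocks
  have hdyadic : ∑ b ∈ Ioc U (U * 2 ^ I), ∑ r ∈ Ioc U (U * 2 ^ I), f b r =
      ∑ i ∈ range I, ∑ j ∈ range I,
        ∑ b ∈ Ioc (U * 2 ^ i) (2 * (U * 2 ^ i)), ∑ r ∈ Ioc (U * 2 ^ j) (2 * (U * 2 ^ j)), f b r := by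
    rw [sum_Ioc_dyadic]
    refine Finset.sum_congr rfl fun i _ => ?_
    rw [Finset.sum_congr rfl fun b _ => sum_Ioc_dyadic (f b) U I, Finset.sum_comm]
  -- (3) per block
  have hper : ∀ i ∈ range I, ∀ j ∈ range I,
      ‖∑ b ∈ Ioc (U * 2 ^ i) (2 * (U * 2 ^ i)), ∑ r ∈ Ioc (U * 2 ^ j) (2 * (U * 2 ^ j)), f b r‖ ≤
        W * Y + (P / W + t / W : ℕ) * Φ := by
    intro i hi j hj
    set M := U * 2 ^ i with hM
    set R := U * 2 ^ j with hR
    have hWY : 0 ≤ (W : ℝ) * Y := mul_nonneg (Nat.cast_nonneg _) hY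
    have hrest : 0 ≤ ((P / W + t / W : ℕ) : ℝ) * Φ := mul_nonneg (Nat.cast_nonneg _) hΦ0
    by_cases hact : M * R < t ∧ P < 4 * M * R
    · have hb := hblock M R ⟨i, Finset.mem_range.mp hi, rfl⟩ ⟨j, Finset.mem_range.mp hj, rfl⟩
        hact.1 hact.2
      refine hb.trans (add_le_add le_rfl ?_)
      have hwin := sum_block_window_le M R (4 * M * R) le_rfl
        (fun n : ℕ => (P < n ∧ n ≤ P + P / W) ∨ (n ≤ t ∧ t < n + t / W)) (fun n => ‖F n‖)
        (fun n => norm_nonneg _)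
      refine hwin.trans ?_
      calc ∑ n ∈ (Ioc 0 (4 * M * R)).filter (fun n : ℕ =>
              (P < n ∧ n ≤ P + P / W) ∨ (n ≤ t ∧ t < n + t / W)), (n.divisors.card : ℝ) * ‖F n‖
          ≤ ∑ n ∈ (Ioc 0 (4 * M * R)).filter (fun n : ℕ =>
              (P < n ∧ n ≤ P + P / W) ∨ (n ≤ t ∧ t < n + t / W)), Φ := by
            refine Finset.sum_le_sum fun n hn => hΦ n ?_
            have h2 := (Finset.mem_filter.mp hn).2
            have : P / W ≤ P := Nat.div_le_self P W
            omega
        _ = (((Ioc 0 (4 * M * R)).filter (fun n : ℕ =>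
              (P < n ∧ n ≤ P + P / W) ∨ (n ≤ t ∧ t < n + t / W))).card : ℝ) * Φ := by
            rw [Finset.sum_const, nsmul_eq_mul]
        _ ≤ (P / W + t / W : ℕ) * Φ := by
            refine mul_le_mul_of_nonneg_right ?_ hΦ0
            exact_mod_cast card_window_le (4 * M * R) P t W
    · -- inactive block: every term vanishes
      have h0 : ∑ b ∈ Ioc M (2 * M), ∑ r ∈ Ioc R (2 * R), f b r = 0 := by
        refine Finset.sum_eq_zero fun b hb => Finset.sum_eq_zero fun r hr => ?_
        rw [Finset.mem_Ioc] at hb hr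
        simp only [hf]
        rw [if_neg]
        intro h
        apply hact
        constructor
        · calc M * R < b * r := Nat.mul_lt_mul'' hb.1 hr.1
            _ ≤ t := h.2
        · calc P < b * r := h.1
            _ ≤ (2 * M) * (2 * R) := Nat.mul_le_mul hb.2 hr.2
            _ = 4 * M * R := by ring
      rw [h0, norm_zero]
      exact add_nonneg hWY hrest
  -- (4) assemble
  rw [houter, hdyadic]
  calc ‖∑ i ∈ range I, ∑ j ∈ range I,
          ∑ b ∈ Ioc (U * 2 ^ i) (2 * (U * 2 ^ i)), ∑ r ∈ Ioc (U * 2 ^ j) (2 * (U * 2 ^ j)), f b r‖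
      ≤ ∑ i ∈ range I, ‖∑ j ∈ range I,
          ∑ b ∈ Ioc (U * 2 ^ i) (2 * (U * 2 ^ i)), ∑ r ∈ Ioc (U * 2 ^ j) (2 * (U * 2 ^ j)), f b r‖ :=
        norm_sum_le _ _
    _ ≤ ∑ i ∈ range I, ∑ j ∈ range I,
          ‖∑ b ∈ Ioc (U * 2 ^ i) (2 * (U * 2 ^ i)), ∑ r ∈ Ioc (U * 2 ^ j) (2 * (U * 2 ^ j)), f b r‖ :=
        Finset.sum_le_sum fun i _ => norm_sum_le _ _
    _ ≤ ∑ i ∈ range I, ∑ j ∈ range I, (W * Y + (P / W + t / W : ℕ) * Φ) :=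
        Finset.sum_le_sum fun i hi => Finset.sum_le_sum fun j hj => hper i hi j hj
    _ = (I : ℝ) ^ 2 * (W * Y + (P / W + t / W : ℕ) * Φ) := by
        rw [Finset.sum_const, Finset.sum_const, Finset.card_range, nsmul_eq_mul, nsmul_eq_mul]
        ring

end Summit.Parity.BatemanHorn.Cruxes.SplitBlockJacobiCorner.Sketch.MbbOfBoxInputs

namespace Summit.Parity.BatemanHorn.Cruxes.SplitBlockJacobiCorner.Sketch

/-- **Registered stub form** (the window count of the block lemma): restated in `∀`-form in the crux-line namespace under
the name registered on stmt-Parity-15002. [folklore] -/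
theorem mbbPieceII_card_window_le :
    ∀ N P t W : ℕ, ((Finset.Ioc 0 N).filter (fun n : ℕ => (P < n ∧ n ≤ P + P / W) ∨ (n ≤ t ∧ t < n + t / W))).card ≤ P / W + t / W :=
  fun N P t W => MbbOfBoxInputs.card_window_le N P t W

end Summit.Parity.BatemanHorn.Cruxes.SplitBlockJacobiCorner.Sketch

end
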